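import Literature.Probability.LatticeModels.SixVertexTwoPointTheorem
import Literature.Probability.LatticeModels.SixVertexPlanarWindowExpectation
import Literature.Probability.LatticeModels.SixVertexGFFInvariance
import Literature.Probability.LatticeModels.SixVertexGFFHeight

/-!
# The planar two-point function is the `L → ∞` limit of the cylinder spectral representation
# (DKLM 2026: Theorem 2.2 + Definition 2.4 + Theorem 23)

H. Duminil-Copin, K. K. Kozlowski, P. Lammers, I. Manolescu, *Gaussian free field convergence of
the six-vertex model with `-1 ≤ Δ ≤ -1/2`*, arXiv:2603.06268 (2026) [DKLM2026SixVertexGFF]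
(`paper:arxiv-2603.06268`, chunks p0009–p0010, p0023, p0039–p0047):

> **Theorem 2.2** (`ℙ = lim_L lim_M ℙ_{𝕋_{M,L}}[·|balanced]`), **Definition 2.4**
> (`Φ_k(u) = 𝔼[∏(h(uᵢ') - h(uᵢ))]`), **Theorem 23** (for the cylinder measure `ℙ_CYL(L)`:
> `Φ₂^{(L)}(u) = ∫ χ^discr_u(a,b) dμ_L(a,b)` for horizontally ordered lattice configurations).

This file connects the objects of the statement file (`IsPlanarSixVertexMeasure`, `heightAt`,
`kPoint`) with the transfer-matrix formalism of Part III: for `P` the planar slope-zero measure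
(`a = b = 1`) and two L-shaped height-difference pairs in horizontally ordered position,

**`Φ₂^P(u) = lim_{ℓ→∞} 𝔼_{CYL(2(ℓ+1))}[X_{u₁u₁'} · τ X_{u₂u₂'}] = lim_{ℓ→∞} Re ∫ χ^discr_u dμ_{2(ℓ+1)}`**

(`IsPlanarSixVertexMeasure.tendsto_cylinderPairExp_kPoint`,
`IsPlanarSixVertexMeasure.tendsto_integral_chiDiscr_kPoint`). Ingredients: the height difference
along an L-path is a signed sum of arrows (`heightAt_lPath_sub`, ice rule `P`-a.s.), hence a
window-local observable (`lPathWindowObs_planeWindow`); its torus reading is the strip observable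
`lPairObs` of Theorem 23 (`lPathWindowObs_torusWindow_eq_torusObs`); window expectations under
`P` are iterated torus limits (`SixVertexPlanarWindowExpectation.lean`), torus expectations of
window functions are `torusCondExp`'s (`torusWindowExp_eq_torusCondExp`), and the `M → ∞` limits
are the cylinder expectations of Theorem 26/23 (`tendsto_torusPairExp_cylinderPairExp`).

## References

* H. Duminil-Copin, K. K. Kozlowski, P. Lammers, I. Manolescu, arXiv:2603.06268 (2026),
  Theorem 2.2, Definitions 2.3–2.4, Theorem 23. [DKLM2026SixVertexGFF]
-/

noncomputable section

open MeasureTheory Set Filter Topology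

namespace Literature.Probability.LatticeModels.SixVertex

/-! ## 1. Window coordinates -/

/-- The window index `z + n ∈ Fin (2n+1)` of an integer coordinate `z ∈ [-n, n]` (clamped outside).
[folklore] -/
def toWin (n : ℕ) (z : ℤ) : Fin (2 * n + 1) := ⟨min (z + n).toNat (2 * n), by omega⟩

/-- The value of the window index. [folklore] -/
theorem toWin_val {n : ℕ} {z : ℤ} (hz : |z| ≤ n) : ((toWin n z : ℕ) : ℤ) = z + n := by
  have := abs_le.1 hz
  simp only [toWin]
  omega

/-- The window of `ω` at a window index is `ω` at the integer coordinates. [folklore] -/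
theorem planeWindow_toWin (n : ℕ) (ω : Config (ℤ × ℤ)) {z₁ z₂ : ℤ} (h₁ : |z₁| ≤ n) (h₂ : |z₂| ≤ n) :
    planeWindow n ω (toWin n z₁, toWin n z₂) = ω (z₁, z₂) := by
  simp only [planeWindow]
  rw [toWin_val h₁, toWin_val h₂]
  congr 1
  ext <;> simp

/-- The torus window of `ω` at a window index is `ω` at the reduced integer coordinates. [folklore] -/
theorem torusWindow_toWin {M L : ℕ} (n : ℕ) (ω : Config (ZMod M × ZMod L)) {z₁ z₂ : ℤ} (h₁ : |z₁| ≤ n)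
    (h₂ : |z₂| ≤ n) : torusWindow n ω (toWin n z₁, toWin n z₂) = ω ((z₁ : ZMod M), (z₂ : ZMod L)) := by
  simp only [torusWindow]
  rw [toWin_val h₁, toWin_val h₂]
  congr 1
  ext <;> push_cast <;> ring

/-! ## 2. The L-path height difference as a signed sum of arrows -/

/-- `eastStep = -arrowSign` of the crossed vertical arrow. [cite: DKLM2026SixVertexGFF, Def. 2.3] -/
theorem eastStep_eq_neg_arrowSign (ω : Config (ℤ × ℤ)) (x y : ℤ) :
    ((eastStep ω x y : ℤ) : ℝ) = -arrowSign ((ω (x + 1, y)).2) := by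
  unfold eastStep arrowSign
  cases (ω (x + 1, y)).2 <;> simp

/-- `northStep = arrowSign` of the crossed horizontal arrow. [cite: DKLM2026SixVertexGFF, Def. 2.3] -/
theorem northStep_eq_arrowSign (ω : Config (ℤ × ℤ)) (x y : ℤ) :
    ((northStep ω x y : ℤ) : ℝ) = arrowSign ((ω (x, y + 1)).1) := by
  unfold northStep arrowSign
  cases (ω (x, y + 1)).1 <;> simp

/-- A forward signed interval sum is a `Finset.range` sum. [folklore] -/
theorem zsumIco_nat (f : ℤ → ℤ) (a : ℤ) (m : ℕ) : zsumIco f a (a + m) = ∑ i ∈ Finset.range m, f (a + i) := by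
  induction m with
  | zero => simp [zsumIco]
  | succ m ih =>
    rw [Nat.cast_succ, ← add_assoc, zsumIco_succ, ih, Finset.sum_range_succ]

/-- **The height difference along an L-path is a signed sum of arrows** (ice configurations):
`h(x+w'+1, y+q) - h(x,y) = -∑_{i ≤ w'} sgn N(x+i+1, y) + ∑_{m<q} sgn E(x+w'+1, y+m+1)` — east over the
vertical arrows of the columns `x+1, …, x+w'+1` on the row `y`, then north over the horizontal arrows
of the column `x+w'+1`. [cite: DKLM2026SixVertexGFF, Def. 2.3] -/
theorem heightAt_lPath_sub (ω : Config (ℤ × ℤ)) (hice : ∀ v, IceRuleAt ω v) (x y : ℤ) (w' q : ℕ) :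
    ((heightAt ω (x + w' + 1, y + q) : ℤ) : ℝ) - (heightAt ω (x, y) : ℝ) =
      (-∑ i : Fin (w' + 1), arrowSign ((ω (x + i + 1, y)).2)) +
        ∑ m ∈ Finset.range q, arrowSign ((ω (x + w' + 1, y + m + 1)).1) := by
  have h := heightAt_sub_heightAt ω hice (x, y) (x + w' + 1, y + q)
  simp only at h
  rw [show (x + w' + 1 : ℤ) = x + ((w' + 1 : ℕ) : ℤ) by push_cast; ring, zsumIco_nat, zsumIco_nat] at h
  rw [← Int.cast_sub, show (x + w' + 1 : ℤ) = x + ((w' + 1 : ℕ) : ℤ) by push_cast; ring, h]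
  push_cast
  rw [Finset.sum_range (fun i => ((eastStep ω (x + i) y : ℤ) : ℝ))]
  congr 1
  · rw [← Finset.sum_neg_distrib]
    refine Finset.sum_congr rfl fun i _ => ?_
    rw [eastStep_eq_neg_arrowSign]
  · refine Finset.sum_congr rfl fun m _ => ?_
    rw [northStep_eq_arrowSign]

/-! ## 3. The window observable of an L-path and its two readings -/

/-- **The L-path height difference read in a window**: `-∑_{i ≤ w'} sgn N(x+i+1, y) + ∑_{m<q} sgn E(x+w'+1, y+m+1)`
as a function of the window pattern. [cite: DKLM2026SixVertexGFF, Def. 2.3 and proof of Theorem 23, Step 2] -/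
def lPathWindowObs (n : ℕ) (x y : ℤ) (w' q : ℕ) (w : Config (Fin (2 * n + 1) × Fin (2 * n + 1))) : ℝ :=
  (-∑ i : Fin (w' + 1), arrowSign ((w (toWin n (x + i + 1), toWin n y)).2)) +
    ∑ m ∈ Finset.range q, arrowSign ((w (toWin n (x + w' + 1), toWin n (y + m + 1))).1)

/-- **Planar reading**: on an ice configuration, the window observable is the height difference
`h(x+w'+1, y+q) - h(x,y)` (all coordinates in `[-n, n]`). [cite: DKLM2026SixVertexGFF, Def. 2.3] -/
theorem lPathWindowObs_planeWindow {n : ℕ} (ω : Config (ℤ × ℤ)) (hice : ∀ v, IceRuleAt ω v) {x y : ℤ} {w' q : ℕ}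
    (hx : |x| ≤ n) (hx' : |x + w' + 1| ≤ n) (hy : |y| ≤ n) (hy' : |y + q| ≤ n) :
    lPathWindowObs n x y w' q (planeWindow n ω) = (heightAt ω (x + w' + 1, y + q) : ℝ) - (heightAt ω (x, y) : ℝ) := by
  have hx1 := abs_le.1 hx
  have hx2 := abs_le.1 hx'
  have hy1 := abs_le.1 hy
  have hy2 := abs_le.1 hy'
  rw [heightAt_lPath_sub ω hice, lPathWindowObs]
  congr 1
  · congr 1
    refine Finset.sum_congr rfl fun i _ => ?_
    have hi := i.2
    rw [planeWindow_toWin n ω (z₁ := x + i + 1) (z₂ := y) (by rw [abs_le]; constructor <;> omega) hy]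
  · refine Finset.sum_congr rfl fun m hm => ?_
    rw [Finset.mem_range] at hm
    rw [planeWindow_toWin n ω (z₁ := x + w' + 1) (z₂ := y + m + 1) hx' (by rw [abs_le]; constructor <;> omega)]

/-- **Torus reading**: the window observable read on the torus window is the strip observable
`lPairObs r' a w' q y₀` of Theorem 23 read on the torus (`x = a - 1`, rows `y₀, …, y₀ + q`).
[cite: DKLM2026SixVertexGFF, proof of Theorem 23, Step 2] -/
theorem lPathWindowObs_torusWindow_eq_torusObs {M L n : ℕ} (ω : Config (ZMod M × ZMod L)) (r' a w' : ℕ)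
    (h : a + w' + 1 ≤ r' + 1) (q y₀ : ℕ) (hn : a + w' ≤ n) (hn' : y₀ + q ≤ n) :
    lPathWindowObs n ((a : ℤ) - 1) y₀ w' q (torusWindow n ω) = torusObs r' (lPairObs r' a w' h q ((y₀ : ℕ) : ZMod L)) ω := by
  rw [torusObs_lPairObs, lPathWindowObs]
  congr 1
  · congr 1
    refine Finset.sum_congr rfl fun i _ => ?_
    have hi := i.2
    rw [torusWindow_toWin n ω (z₁ := (a : ℤ) - 1 + i + 1) (z₂ := y₀) (by rw [abs_le]; constructor <;> omega)
      (by rw [abs_le]; constructor <;> omega)]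
    have e : ((((a : ℤ) - 1 + (i : ℕ) + 1 : ℤ) : ZMod M), (((y₀ : ℕ) : ℤ) : ZMod L)) =
        ((((a + (i : ℕ) : ℕ) : ℕ) : ZMod M), ((y₀ : ℕ) : ZMod L)) := by
      ext
      · push_cast; ring
      · push_cast; ring
    rw [e]
  · refine Finset.sum_congr rfl fun m hm => ?_
    rw [Finset.mem_range] at hm
    rw [torusWindow_toWin n ω (z₁ := (a : ℤ) - 1 + w' + 1) (z₂ := (y₀ : ℤ) + m + 1) (by rw [abs_le]; constructor <;> omega)
      (by rw [abs_le]; constructor <;> omega)]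
    have e : ((((a : ℤ) - 1 + w' + 1 : ℤ) : ZMod M), (((y₀ : ℤ) + m + 1 : ℤ) : ZMod L)) =
        ((((a + w' : ℕ) : ℕ) : ZMod M), ((y₀ : ℕ) : ZMod L) + (m + 1) • (1 : ZMod L)) := by
      ext
      · push_cast; ring
      · rw [nsmul_eq_mul, mul_one]; push_cast; ring
    rw [e]

/-- The same for a torus configuration translated by `t` columns: the window observable based at
column `t + a - 1` reads `lPairObs r' a w' q y₀` on `ω(· + (t, 0))` (the second factor of `torusPairObs`).
[cite: DKLM2026SixVertexGFF, Theorem 26 (i) (the pair observable `X · τ_{(t,0)} Y`)] -/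
theorem lPathWindowObs_torusWindow_eq_torusObs_shift {M L n : ℕ} (ω : Config (ZMod M × ZMod L)) (t r' a w' : ℕ)
    (h : a + w' + 1 ≤ r' + 1) (q y₀ : ℕ) (hn : t + a + w' ≤ n) (hn' : y₀ + q ≤ n) :
    lPathWindowObs n ((t + a : ℕ) - 1 : ℤ) y₀ w' q (torusWindow n ω) =
      torusObs r' (lPairObs r' a w' h q ((y₀ : ℕ) : ZMod L)) (fun v => ω (v + (((t : ℕ) : ZMod M), 0))) := by
  rw [torusObs_lPairObs, lPathWindowObs]
  congr 1
  · congr 1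
    refine Finset.sum_congr rfl fun i _ => ?_
    have hi := i.2
    rw [torusWindow_toWin n ω (z₁ := ((t + a : ℕ) - 1 : ℤ) + i + 1) (z₂ := y₀)
      (by rw [abs_le]; constructor <;> push_cast <;> omega) (by rw [abs_le]; constructor <;> omega)]
    have e : (((((t + a : ℕ) : ℤ) - 1 + (i : ℕ) + 1 : ℤ) : ZMod M), (((y₀ : ℕ) : ℤ) : ZMod L)) =
        ((((a + (i : ℕ) : ℕ) : ℕ) : ZMod M), ((y₀ : ℕ) : ZMod L)) + (((t : ℕ) : ZMod M), 0) := by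
      rw [Prod.mk_add_mk, add_zero]
      ext
      · push_cast; ring
      · push_cast; ring
    rw [e]
  · refine Finset.sum_congr rfl fun m hm => ?_
    rw [Finset.mem_range] at hm
    rw [torusWindow_toWin n ω (z₁ := ((t + a : ℕ) - 1 : ℤ) + w' + 1) (z₂ := (y₀ : ℤ) + m + 1)
      (by rw [abs_le]; constructor <;> push_cast <;> omega) (by rw [abs_le]; constructor <;> omega)]
    have e : (((((t + a : ℕ) : ℤ) - 1 + w' + 1 : ℤ) : ZMod M), (((y₀ : ℤ) + m + 1 : ℤ) : ZMod L)) =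
        ((((a + w' : ℕ) : ℕ) : ZMod M), ((y₀ : ℕ) : ZMod L) + (m + 1) • (1 : ZMod L)) + (((t : ℕ) : ZMod M), 0) := by
      rw [Prod.mk_add_mk, add_zero, nsmul_eq_mul, mul_one]
      ext
      · push_cast; ring
      · push_cast; ring
    rw [e]

/-! ## 4. Torus expectations of window functions -/

/-- **Torus expectations of window functions are conditional torus expectations**:
`∑_s g(s) ℙ_{𝕋_{M,L}}[torusWindow n = s | balanced] = 𝔼_{𝕋_{M,L}}[g ∘ torusWindow n | balanced]`.
[cite: DKLM2026SixVertexGFF, Def. 2.1 and Thm. 2.2] -/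
theorem torusWindowExp_eq_torusCondExp (a b c : ℝ) (M L : ℕ) [NeZero M] [NeZero L] (n : ℕ)
    (g : Config (Fin (2 * n + 1) × Fin (2 * n + 1)) → ℝ) :
    torusWindowExp a b c M L n g = torusCondExp a b c (fun ω : Config (ZMod M × ZMod L) => g (torusWindow n ω)) := by
  have hM : M ≠ 0 := NeZero.ne M
  have hL : L ≠ 0 := NeZero.ne L
  unfold torusWindowExp torusCondProbNat
  simp only [hM, hL, dite_false]
  have hpt : (fun ω : Config (ZMod M × ZMod L) => g (torusWindow n ω)) =
      fun ω => ∑ s : Config (Fin (2 * n + 1) × Fin (2 * n + 1)),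
        g s * (if ω ∈ {ω' : Config (ZMod M × ZMod L) | torusWindow n ω' ∈ ({s} : Set _)} then 1 else 0) := by
    funext ω
    simp only [mem_setOf_eq, mem_singleton_iff, mul_ite, mul_one, mul_zero]
    rw [Finset.sum_ite_eq]
    simp
  rw [hpt, torusCondExp_finset_sum]
  refine Finset.sum_congr rfl fun s _ => ?_
  rw [torusCondProb_eq_torusCondExp, ← torusCondExp_smul]
  congr 1
  funext ω
  simp only [Pi.smul_apply, smul_eq_mul, mem_setOf_eq, mem_singleton_iff]

/-! ## 5. The planar two-point function as a limit of cylinder two-point functions -/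

/-- The lattice point `m + in ∈ ℂ`. [folklore] -/
def latticePt (m n : ℤ) : ℂ := ⟨m, n⟩

/-- `heightPlane` at a lattice point is `heightAt` at that face. [cite: DKLM2026SixVertexGFF, §2.2] -/
theorem heightPlane_latticePt (ω : Config (ℤ × ℤ)) (m n : ℤ) : heightPlane ω (latticePt m n) = heightAt ω (m, n) := by
  simp [heightPlane, latticePt]

/-- **The horizontally ordered configuration of two L-shaped pairs** matching the cylinder pair
observable `lPairObs r₁' a₁ w₁' q₁ y₀ · τ_{(r₁'+1+k,0)} lPairObs r₂' a₂ w₂' q₂ y₂` of Theorem 23: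
`u₁ = (a₁-1, y₀)`, `u₁' = (a₁+w₁', y₀+q₁)`, `u₂ = (r₁'+k+a₂, y₂)`, `u₂' = (r₁'+1+k+a₂+w₂', y₂+q₂)` (faces).
[cite: DKLM2026SixVertexGFF, Theorem 23 (horizontally ordered pairs)] -/
def lPairConfig (r₁' a₁ w₁' q₁ a₂ w₂' q₂ y₀ y₂ k : ℕ) : Fin 2 → ℂ × ℂ :=
  ![(latticePt ((a₁ : ℤ) - 1) y₀, latticePt ((a₁ : ℤ) - 1 + w₁' + 1) ((y₀ : ℤ) + q₁)),
    (latticePt ((r₁' + 1 + k + a₂ : ℕ) - 1 : ℤ) y₂, latticePt (((r₁' + 1 + k + a₂ : ℕ) - 1 : ℤ) + w₂' + 1) ((y₂ : ℤ) + q₂))]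

/-- **The window observable of the two pairs**: the product of the two L-path window observables.
[cite: DKLM2026SixVertexGFF, Def. 2.4 and Theorem 23] -/
def lPairWindowObs (n r₁' a₁ w₁' q₁ a₂ w₂' q₂ y₀ y₂ k : ℕ) (w : Config (Fin (2 * n + 1) × Fin (2 * n + 1))) : ℝ :=
  lPathWindowObs n ((a₁ : ℤ) - 1) y₀ w₁' q₁ w * lPathWindowObs n ((r₁' + 1 + k + a₂ : ℕ) - 1 : ℤ) y₂ w₂' q₂ w

/-- **Planar reading of the pair observable** = the integrand of `Φ₂^P` at `lPairConfig` (ice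
configurations, window large enough). [cite: DKLM2026SixVertexGFF, Def. 2.4] -/
theorem lPairWindowObs_planeWindow {n : ℕ} (r₁' a₁ w₁' q₁ a₂ w₂' q₂ y₀ y₂ k : ℕ) (ω : Config (ℤ × ℤ))
    (hice : ∀ v, IceRuleAt ω v) (hn : r₁' + 1 + k + a₂ + w₂' + a₁ + w₁' + y₀ + q₁ + y₂ + q₂ + 1 ≤ n) :
    lPairWindowObs n r₁' a₁ w₁' q₁ a₂ w₂' q₂ y₀ y₂ k (planeWindow n ω) =
      ∏ i, ((heightPlane ω ((lPairConfig r₁' a₁ w₁' q₁ a₂ w₂' q₂ y₀ y₂ k) i).2 : ℝ) -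
        (heightPlane ω ((lPairConfig r₁' a₁ w₁' q₁ a₂ w₂' q₂ y₀ y₂ k) i).1 : ℝ)) := by
  rw [Fin.prod_univ_two]
  simp only [lPairConfig, Matrix.cons_val_zero, Matrix.cons_val_one, heightPlane_latticePt, lPairWindowObs]
  rw [lPathWindowObs_planeWindow ω hice (by rw [abs_le]; constructor <;> omega) (by rw [abs_le]; constructor <;> omega)
      (by rw [abs_le]; constructor <;> omega) (by rw [abs_le]; constructor <;> omega),
    lPathWindowObs_planeWindow ω hice (by rw [abs_le]; constructor <;> omega) (by rw [abs_le]; constructor <;> omega)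
      (by rw [abs_le]; constructor <;> omega) (by rw [abs_le]; constructor <;> omega)]

/-- **Torus reading of the pair observable** = the pair observable `X₁ · τ_{(r₁'+1+k,0)} X₂` of
Theorem 23 read on the torus. [cite: DKLM2026SixVertexGFF, Theorem 26 (i) / Theorem 23] -/
theorem lPairWindowObs_torusWindow {M L n : ℕ} {r₁' r₂' : ℕ} (a₁ w₁' : ℕ) (h₁ : a₁ + w₁' + 1 ≤ r₁' + 1) (q₁ : ℕ)
    (a₂ w₂' : ℕ) (h₂ : a₂ + w₂' + 1 ≤ r₂' + 1) (q₂ y₀ y₂ k : ℕ) (ω : Config (ZMod M × ZMod L))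
    (hn : r₁' + 1 + k + a₂ + w₂' + a₁ + w₁' + y₀ + q₁ + y₂ + q₂ + 1 ≤ n) :
    lPairWindowObs n r₁' a₁ w₁' q₁ a₂ w₂' q₂ y₀ y₂ k (torusWindow n ω) =
      torusPairObs r₁' (lPairObs r₁' a₁ w₁' h₁ q₁ ((y₀ : ℕ) : ZMod L)) (r₁' + 1 + k) r₂'
        (lPairObs r₂' a₂ w₂' h₂ q₂ ((y₂ : ℕ) : ZMod L)) ω := by
  rw [lPairWindowObs, torusPairObs, lPathWindowObs_torusWindow_eq_torusObs ω r₁' a₁ w₁' h₁ q₁ y₀ (by omega) (by omega),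
    lPathWindowObs_torusWindow_eq_torusObs_shift ω (r₁' + 1 + k) r₂' a₂ w₂' h₂ q₂ y₂ (by omega) (by omega)]

/-- **`Φ₂^P` at `lPairConfig` is the integral of the pair window observable** (ice rule `P`-a.s.).
[cite: DKLM2026SixVertexGFF, Def. 2.4] -/
theorem kPoint_lPairConfig_eq_integral {c : ℝ} {P : Measure (Config (ℤ × ℤ))} (hP : IsPlanarSixVertexMeasure 1 1 c P)
    (r₁' a₁ w₁' q₁ a₂ w₂' q₂ y₀ y₂ k : ℕ) {n : ℕ} (hn : r₁' + 1 + k + a₂ + w₂' + a₁ + w₁' + y₀ + q₁ + y₂ + q₂ + 1 ≤ n) :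
    kPoint P 2 (lPairConfig r₁' a₁ w₁' q₁ a₂ w₂' q₂ y₀ y₂ k) =
      ∫ ω, lPairWindowObs n r₁' a₁ w₁' q₁ a₂ w₂' q₂ y₀ y₂ k (planeWindow n ω) ∂P := by
  unfold kPoint
  refine integral_congr_ae ?_
  filter_upwards [hP.ae_iceRuleAt] with ω hω
  exact (lPairWindowObs_planeWindow r₁' a₁ w₁' q₁ a₂ w₂' q₂ y₀ y₂ k ω hω hn).symm

/-- **The planar two-point function is the limit of the cylinder two-point functions**: for the
planar slope-zero six-vertex measure `P` (`a = b = 1`, `c > 0`) and the horizontally ordered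
configuration `u = lPairConfig …` of two L-shaped pairs,
`Φ₂^P(u) = lim_{ℓ → ∞} 𝔼_{CYL(2(ℓ+1))}[X_{u₁u₁'} · τ_{(r₁'+1+k,0)} X_{u₂u₂'}]`.
[cite: DKLM2026SixVertexGFF, Theorem 2.2, Def. 2.4 and Theorem 23] -/
theorem IsPlanarSixVertexMeasure.tendsto_cylinderPairExp_kPoint {c : ℝ} (hc : 0 < c) {P : Measure (Config (ℤ × ℤ))}
    (hP : IsPlanarSixVertexMeasure 1 1 c P) {r₁' r₂' : ℕ} (a₁ w₁' : ℕ) (h₁ : a₁ + w₁' + 1 ≤ r₁' + 1) (q₁ : ℕ)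
    (a₂ w₂' : ℕ) (h₂ : a₂ + w₂' + 1 ≤ r₂' + 1) (q₂ y₀ y₂ k : ℕ) :
    Tendsto (fun ℓ : ℕ => cylinderPairExp c r₁' (lPairObs r₁' a₁ w₁' h₁ q₁ ((y₀ : ℕ) : ZMod (2 * (ℓ + 1)))) (r₁' + 1 + k) r₂'
        (lPairObs r₂' a₂ w₂' h₂ q₂ ((y₂ : ℕ) : ZMod (2 * (ℓ + 1))))) atTop
      (𝓝 (kPoint P 2 (lPairConfig r₁' a₁ w₁' q₁ a₂ w₂' q₂ y₀ y₂ k))) := by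
  set n : ℕ := r₁' + 1 + k + a₂ + w₂' + a₁ + w₁' + y₀ + q₁ + y₂ + q₂ + 1 with hn
  set g := lPairWindowObs n r₁' a₁ w₁' q₁ a₂ w₂' q₂ y₀ y₂ k with hg
  obtain ⟨qs, hin, hout⟩ := hP.exists_tendsto_integral_comp_planeWindow n g
  rw [← kPoint_lPairConfig_eq_integral hP r₁' a₁ w₁' q₁ a₂ w₂' q₂ y₀ y₂ k le_rfl] at hout
  -- identify the inner limits for the even heights `2(ℓ+1)`
  have hq : ∀ ℓ : ℕ, qs (ℓ + 1) = cylinderPairExp c r₁' (lPairObs r₁' a₁ w₁' h₁ q₁ ((y₀ : ℕ) : ZMod (2 * (ℓ + 1))))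
      (r₁' + 1 + k) r₂' (lPairObs r₂' a₂ w₂' h₂ q₂ ((y₂ : ℕ) : ZMod (2 * (ℓ + 1)))) := by
    intro ℓ
    have h1 := hin (ℓ + 1)
    have h2 := tendsto_torusPairExp_cylinderPairExp c hc (G₂ := ZMod (2 * (ℓ + 1)))
      (lPairObs r₁' a₁ w₁' h₁ q₁ ((y₀ : ℕ) : ZMod (2 * (ℓ + 1)))) (lPairObs r₂' a₂ w₂' h₂ q₂ ((y₂ : ℕ) : ZMod (2 * (ℓ + 1)))) k
    refine tendsto_nhds_unique h1 (h2.congr' ?_)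
    filter_upwards [eventually_ge_atTop 1] with M hM
    haveI : NeZero M := ⟨by omega⟩
    rw [torusWindowExp_eq_torusCondExp]
    unfold torusPairExp
    rw [dif_neg (by omega)]
    exact congrArg (torusCondExp 1 1 c) (funext fun ω =>
      (lPairWindowObs_torusWindow a₁ w₁' h₁ q₁ a₂ w₂' h₂ q₂ y₀ y₂ k ω le_rfl).symm)
  have := hout.comp (tendsto_add_atTop_nat 1)
  refine this.congr fun ℓ => ?_
  exact hq ℓ

/-- **`Φ₂^P(u) = lim_{ℓ→∞} Re ∫ χ^discr_u dμ_{2(ℓ+1)}`**: the planar two-point function at the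
horizontally ordered L-L configuration `u = lPairConfig …` is the `L → ∞` limit of the spectral
integrals of Theorem 23 (`x₁ = w₁'+1`, `y₁ = q₁`, `x₁' = (r₁'-a₁-w₁')+k+a₂`, `y₁' = y₂-y₀-q₁`,
`x₂ = w₂'+1`, `y₂ = q₂`). [cite: DKLM2026SixVertexGFF, Theorem 2.2, Def. 2.4 and Theorem 23] -/
theorem IsPlanarSixVertexMeasure.tendsto_integral_chiDiscr_kPoint {c : ℝ} (hc : 0 < c) {P : Measure (Config (ℤ × ℤ))}
    (hP : IsPlanarSixVertexMeasure 1 1 c P) {r₁' r₂' : ℕ} (a₁ w₁' : ℕ) (h₁ : a₁ + w₁' + 1 ≤ r₁' + 1) (q₁ : ℕ)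
    (a₂ w₂' : ℕ) (h₂ : a₂ + w₂' + 1 ≤ r₂' + 1) (q₂ y₀ y₂ k : ℕ) :
    Tendsto (fun ℓ : ℕ => (∫ p, chiDiscr (w₁' + 1) q₁ ((r₁' - a₁ - w₁') + k + a₂) ((y₂ : ℤ) - y₀ - q₁) (w₂' + 1) q₂ p
        ∂dklmMeasure c hc ℓ).re) atTop
      (𝓝 (kPoint P 2 (lPairConfig r₁' a₁ w₁' q₁ a₂ w₂' q₂ y₀ y₂ k))) := by
  refine (hP.tendsto_cylinderPairExp_kPoint hc a₁ w₁' h₁ q₁ a₂ w₂' h₂ q₂ y₀ y₂ k).congr fun ℓ => ?_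
  rw [← cylinderPairExp_lPairObs_lPairObs_eq_integral c hc ℓ a₁ w₁' h₁ q₁ a₂ w₂' h₂ q₂ y₀ y₂ k, Complex.ofReal_re]

end Literature.Probability.LatticeModels.SixVertex

end
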